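import Summits.PneNP.PneNP.Theorems.ExpanderLinearGeneratorsNoPolyBoundedProofSystemBootstrap
import Summits.PneNP.PneNP.Theorems.ExpanderLinearGeneratorsNoPolyBoundedProofSystemStretching

/-!
# Crux `ProofcplxThesis` / `NoPolyBoundedProofSystem` (item `stmt-PneNP-0097`) — line `Sketch`,
# bootstrap composition (Krajíček 2004, Fund. Math. 182, Thm. 3.1(ii)/4.2): SKELETON

Line lead's skeleton for the crux `X := ¬ HasPolyBoundedProofSystem TAUT` (≡ `NP ≠ coNP`,
`noPolyBoundedProofSystem_iff_NP_ne_coNP`). Composition (idea card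
`Cruxes/ProofcplxThesis/Ideas/collapse-feeds-generator.md`):

* BOOTSTRAP (provable, proved here modulo two registered stubs): `NP = coNP` ⇒ there is a language
  `L ∈ NE ∩ coNE` of circuit complexity `≥ 2^{n/8}` at every large length. The language is the
  scaled Kannan diagonal language `KannanScaled.diag N` of `ScaledKannanDiagonal.lean` at the
  quarter-exponential scale `N(n) = 2^{⌊⌊n/2⌋/2⌋+2} + ⌊⌊n/2⌋/2⌋ + 3`; it is read off Kannan's
  `Σ₄ᵖ` language `Kannan.lang 0` at the padded input `pad (N |y|) y`, so under the collapse
  `PH = NP = coNP` it and its complement are `NP`-preimages under a `2^{O(n)}`-time map, hence in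
  `NE` (`preimage_mem_NE_of_mem_FE`); the lower bound is `KannanScaled.lt_circuitSize_diag`.
  Its two stubs LANDED (wave 1): `quarterPad_mem_FE` (the padding map is computable in time
  `2^{O(n)}`; Theorems …QuarterPad, p136432) and `eventually_le_circuitSize_diag_quarter` (the
  lower bound at scale `N`; Theorems …QuarterScale, p136462) — imported above.
* CONDITIONAL GENERATOR (the crux-sized stub `conditionalGenerator_of_hardLanguage`): an
  exponentially hard language in `NE ∩ coNE` yields a map `g` stretching by one bit whose range
  is in `NP` and whose
  range-complement has no polynomially bounded proof system (Razborov's Conjecture 2 / Krajíček's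
  conditional generator, language-level form).
* COMPOSITION `noPolyBoundedProofSystem_of` / `proofcplxThesis_of`: if `X` failed then `NP = coNP`
  (Cook–Reckhow), the bootstrap (LANDED: Theorems …Bootstrap, p136734) gives the hard language, the
  stub gives `g`, but `(range g)ᶜ ∈ coNP = NP` has a polynomially bounded proof system (Cook–Reckhow,
  general form) — contradiction (composition step LANDED: Theorems …Stretching, p136762, together
  with its converse: the stub's conclusion is equivalent to `X`, and — given the bootstrap — the
  stub itself, read as one closed statement, is equivalent to `X`:
  `conditionalGenerator_iff_noPolyBoundedProofSystem`, p136832).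

Sources: J. Krajíček, *Dual weak pigeonhole principle, pseudo-surjective functions, and provability
of circuit lower bounds*, JSL 69 (2004) / *Diagonalization in proof complexity*, Fund. Math. 182
(2004) 181–192, Thm. 3.1(ii), Thm. 4.2; R. Kannan, Inform. Control 55 (1982), Lemma 1;
S. A. Cook, R. A. Reckhow, JSL 44 (1979), Prop. 1.1, 1.4.
-/

set_option linter.dupNamespace false -- `Summit.PneNP.PneNP.…`: summit = sub-problem name (D-0017 single-conjunct layout)

namespace Summit.PneNP.PneNP.Theorems.Bootstrap

open Filter
open Literature.Computability.Complexity Literature.Computability.MetaComplexity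
open Summit.PneNP.PneNP.Theses

/-! ### The open stub (registered on stmt-PneNP-0097) -/

/-- STUB (crux-sized: the conditional proof complexity generator). An exponentially hard language
in `NE ∩ coNE` yields a one-bit-stretching map with `NP` range whose range-complement has no
polynomially bounded proof system. [cite: Krajicek2004Diagonalization, Thm. 4.2] -/
theorem conditionalGenerator_of_hardLanguage (L : Language Bool) (hL : L ∈ NE) (hLc : Lᶜ ∈ NE)
    (δ : ℝ) (hδ : 0 < δ) (hhard : ∀ᶠ n : ℕ in atTop, (2 : ℝ) ^ (δ * n) ≤ (L.circuitSize n : ℝ)) :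
    ∃ g : List Bool → List Bool, (∀ x, (g x).length = x.length + 1) ∧
      Set.range g ∈ Nondeterministic.NP ∧ ¬ HasPolyBoundedProofSystem (Set.range g)ᶜ := by
  sorry

/-! ### Composition -/

/-- **The crux from the stub**, shared decl of route ExpanderLinearGenerators: if `X` failed, the
landed bootstrap (`hardLanguageInNEcoNE_of_not_noPolyBoundedProofSystem`, Theorems …Bootstrap)
gives a `2^{n/8}`-hard language in `NE ∩ coNE`, the stub gives the stretching map, and the landed
composition step (`noPolyBoundedProofSystem_of_exists_stretching`, Theorems …Stretching) gives `X`.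
[cite: CookReckhow1979, §1 Prop. 1.1] -/
theorem noPolyBoundedProofSystem_of : ExpanderLinearGenerators.NoPolyBoundedProofSystem := by
  by_contra hX
  obtain ⟨L, hL, hLc, δ, hδ, hhard⟩ := hardLanguageInNEcoNE_of_not_noPolyBoundedProofSystem hX
  exact hX (noPolyBoundedProofSystem_of_exists_stretching
    (conditionalGenerator_of_hardLanguage L hL hLc δ hδ hhard))

/-- The same for the crux decl of route ProofCplx (`Iff.rfl` with the shared decl).
[cite: CookReckhow1979, §1 Prop. 1.1] -/
theorem proofcplxThesis_of : ProofCplx.ProofcplxThesis :=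
  noPolyBoundedProofSystem_iff_proofcplxThesis.1 noPolyBoundedProofSystem_of

end Summit.PneNP.PneNP.Theorems.Bootstrap
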